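import Literature.NumberTheory.EllipticCurves.IwasawaAlgebraProofs
import Literature.NumberTheory.EllipticCurves.IwasawaAlgebraPseudoNullProofs
import Literature.NumberTheory.EllipticCurves.IwasawaAlgebraCharIdealProofs
import Literature.NumberTheory.EllipticCurves.IwasawaAlgebraPseudoIsomorphicProofs
import Literature.NumberTheory.EllipticCurves.CharIdealCokernelDetProofs
import HarnessLib

/-!
# Stub-ideation k3 (gen 4) sketch for `stub_heegnerIndexLowerAtTwo`
# (crux `PrintCf2.SplitBadTwoLowerHalfOfFacts`, item stmt-BirchSwinnertonDyer-27851)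
# — DECOMPOSITION of the critic's node **R2c** («THE local brick», STUB-PLAN v1.5 row 68:
# `char_Λ(U_𝔭̄(F_∞)/C̄_∞)·𝒪⟦T⟧ = (Gp·G)`) into print/theorem-shaped sub-stubs R2c-i … R2c-v
# glued by the one-variable characteristic-ideal calculus PROVED below (§A–§C), plus ONE sorried
# abstract helper (§D, the coinvariant transport used by Plan 3).

BSD is NOT proved by any of this; nothing here closes the crux, the stub, T1⁻ or R2c.  §A–§C are
sorry-free commutative algebra over `Λ = IwasawaAlgebra p` (any prime `p`; used at `p = 2`);
the arithmetic sub-stubs R2c-i…v (de Shalit I (17) + I.3.9; local class field theory descent;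
semi-local induction; de Shalit II.4.14 at `p = 2`; norm relations) are NOT typed here — their
carriers (`𝒰(ℚ₂^{ab})`, measure algebras, elliptic-unit systems) do not exist in the tree; the card
`Ideas/stub-heegnerindexloweratwo-k3-g4.md` maps each to its printed source and to the hypothesis
of `charIdeal_quotient_map_eq_mul` (§C) it instantiates.
-/

set_option autoImplicit false
set_option linter.dupNamespace false

noncomputable section

open scoped Classical

namespace Summit.BirchSwinnertonDyer.BirchSwinnertonDyer.Cruxes.SplitBadTwoLowerHalfOfFacts.StubIdeasK3G4

open Literature.NumberTheory.EllipticCurves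

/-! ## §A  The map induced on quotients by a «Coleman-type» map `col : U → L` and a submodule `C ≤ U` -/

section Quot

variable {R : Type*} [CommRing R] {U L : Type*} [AddCommGroup U] [Module R U]
  [AddCommGroup L] [Module R L]

/-- The induced map `U ⧸ C → L ⧸ col(C)` (in R2c: semi-local units mod elliptic units → measures
mod the image of the elliptic units). -/
def quotMap (col : U →ₗ[R] L) (C : Submodule R U) : (U ⧸ C) →ₗ[R] (L ⧸ C.map col) :=
  Submodule.mapQ C (C.map col) col (Submodule.le_comap_map col C)

theorem quotMap_comp_mkQ (col : U →ₗ[R] L) (C : Submodule R U) :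
    (quotMap col C).comp C.mkQ = (C.map col).mkQ.comp col :=
  Submodule.mapQ_mkQ C (C.map col) col

@[simp] theorem quotMap_mk (col : U →ₗ[R] L) (C : Submodule R U) (u : U) :
    quotMap col C (Submodule.Quotient.mk u) = Submodule.Quotient.mk (col u) := rfl

/-- **Kernel of the induced map** = image of `ker col` in `U ⧸ C`. -/
theorem ker_quotMap (col : U →ₗ[R] L) (C : Submodule R U) :
    LinearMap.ker (quotMap col C) = (LinearMap.ker col).map C.mkQ := by
  ext x
  obtain ⟨u, rfl⟩ := Submodule.mkQ_surjective C x
  simp only [LinearMap.mem_ker, Submodule.mkQ_apply, quotMap_mk, Submodule.Quotient.mk_eq_zero,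
    Submodule.mem_map]
  constructor
  · rintro ⟨c, hc, hcu⟩
    refine ⟨u - c, by simp [map_sub, hcu], ?_⟩
    rw [Submodule.Quotient.eq]
    simpa using C.neg_mem hc
  · rintro ⟨y, hy, hyu⟩
    rw [Submodule.Quotient.eq] at hyu
    refine ⟨u - y, by simpa using C.neg_mem hyu, ?_⟩
    rw [map_sub, LinearMap.mem_ker.mp hy, sub_zero]

/-- **Range of the induced map** = image of `range col` in `L ⧸ col(C)`. -/
theorem range_quotMap (col : U →ₗ[R] L) (C : Submodule R U) :
    LinearMap.range (quotMap col C) = (LinearMap.range col).map (C.map col).mkQ := by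
  have h : LinearMap.range ((quotMap col C).comp C.mkQ) = LinearMap.range (quotMap col C) :=
    LinearMap.range_comp_of_range_eq_top _ (Submodule.range_mkQ C)
  rw [← h, quotMap_comp_mkQ, LinearMap.range_comp]

/-- The kernel of the induced map is finite when `ker col` is (it is a quotient of it). -/
theorem finite_ker_quotMap (col : U →ₗ[R] L) (C : Submodule R U) [Finite (LinearMap.ker col)] :
    Finite (LinearMap.ker (quotMap col C)) := by
  rw [ker_quotMap]
  refine Finite.of_surjective
    (fun y : LinearMap.ker col => (⟨C.mkQ y, Submodule.mem_map_of_mem y.2⟩ :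
      (LinearMap.ker col).map C.mkQ)) ?_
  rintro ⟨x, hx⟩
  obtain ⟨y, hy, rfl⟩ := Submodule.mem_map.mp hx
  exact ⟨⟨y, hy⟩, rfl⟩

end Quot

/-! ## §B  G1: quotient transport of characteristic ideals along a map with FINITE kernel
(finite `Λ`-modules are pseudo-null — tree `isPseudoNull_of_finite` — hence invisible to `char`). -/

section Transport

variable (p : ℕ) [Fact p.Prime] {U L : Type*} [AddCommGroup U] [Module (IwasawaAlgebra p) U]
  [AddCommGroup L] [Module (IwasawaAlgebra p) L]

/-- **G1.** If `col : U → L` has finite kernel then `char_Λ(U ⧸ C) = char_Λ(image of col(U) in L ⧸ col(C))`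
— the quotient `U ⧸ C` is pseudo-isomorphic to `col(U)/col(C)`. No `μ = 0`, no idempotents, any `p`. -/
theorem charIdeal_quot_eq_charIdeal_range_map (col : U →ₗ[IwasawaAlgebra p] L)
    (C : Submodule (IwasawaAlgebra p) U) [Finite (LinearMap.ker col)] :
    Module.charIdeal (IwasawaAlgebra p) (U ⧸ C) =
      Module.charIdeal (IwasawaAlgebra p) ((LinearMap.range col).map (C.map col).mkQ) := by
  rw [← range_quotMap]
  refine Module.charIdeal_eq_of_arePseudoIsomorphic ⟨(quotMap col C).rangeRestrict, ?_, ?_⟩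
  · haveI := finite_ker_quotMap col C
    rw [LinearMap.ker_rangeRestrict]
    exact isPseudoNull_of_finite p _
  · haveI : Subsingleton (LinearMap.range (quotMap col C) ⧸
        LinearMap.range (quotMap col C).rangeRestrict) := by
      rw [LinearMap.range_rangeRestrict]
      exact Submodule.Quotient.subsingleton_iff.mpr rfl
    exact isPseudoNull_of_finite p _

/-! ## §C  G5: the R2c GLUE — `char(L ⧸ col C) = char(U ⧸ C) · char(L ⧸ col U)`.

R2c reading (card Plan 1): `U` = semi-local principal units at 𝔭̄ of the 𝔭-tower `F_∞` (⊗ 𝒪̂, as a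
`Λ(Γ′)`-module with Δ inside), `C` = closure of the elliptic units, `L` = `Λ(Gal(F_∞/K)) ⊗ 𝒪̂`,
`col` = de Shalit's canonical `i` of (17) descended to `F_{∞,w}` and induced (R2c-i,ii,iii: FINITE kernel),
`L ⧸ col U` = the local-CFT descent module `⊕_w Gal`-part `≅ ℤ₂^{r}` (trivial action) ⊕ finite, whose
char is `(T)^r` (E₀'s trivial zero, PLUS branch) — R2c-ii; `col C` = `12·𝒥_F·𝓛|_F · L` — R2c-iv,v.
Then §C + §B′ below give `char(U ⧸ C̄)·(T)^r = char(L ⧸ 12𝒥𝓛 L) = (4)^{rk} · (Gp·G)` (𝒥_F of finite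
index): the identity R2c with every 2-power EXPLICIT (critic P-norm / B8). -/

theorem charIdeal_quotient_map_eq_mul (col : U →ₗ[IwasawaAlgebra p] L)
    (C : Submodule (IwasawaAlgebra p) U) [Finite (LinearMap.ker col)]
    [Module.Finite (IwasawaAlgebra p) (L ⧸ C.map col)]
    (htor : Module.IsTorsion (IwasawaAlgebra p) (L ⧸ C.map col)) :
    Module.charIdeal (IwasawaAlgebra p) (L ⧸ C.map col) =
      Module.charIdeal (IwasawaAlgebra p) (U ⧸ C) *
        Module.charIdeal (IwasawaAlgebra p) (L ⧸ LinearMap.range col) := by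
  set T := (LinearMap.range col).map (C.map col).mkQ with hT
  have hSES := Module.charIdeal_eq_mul_of_exact htor T.subtype T.mkQ
    (Submodule.subtype_injective T) (Submodule.mkQ_surjective T) (LinearMap.exact_subtype_mkQ T)
  rw [hSES, charIdeal_quot_eq_charIdeal_range_map p col C, ← hT]
  congr 1
  exact Module.charIdeal_eq_of_arePseudoIsomorphic
    ⟨_, LinearMap.IsPseudoIsomorphism.of_linearEquiv
      (Submodule.quotientQuotientEquivQuotient (C.map col) (LinearMap.range col)
        LinearMap.map_le_range)⟩

end Transport

/-! ## §B′  G4: the TOTAL characteristic ideal over `Λ` of a cyclic `Λ[Δ]`-module, `Δ = {1, δ}` of order 2: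
multiplication by `f = a + b·δ` on `Λ[Δ] ≅ Λ²` (basis `1, δ`) has matrix `(a b; b a)` and
`char_Λ(Λ[Δ]/f) = (det) = ((a+b)(a−b)) = (f(δ=1) · f(δ=−1)) = (Gp · G)` — the «plus × minus» factorisation
of R2c's right-hand side WITHOUT the idempotents `(1 ± δ)/2 ∉ Λ[Δ]` (2 ∉ Λˣ). -/

section NormOrderTwo

variable (p : ℕ) [Fact p.Prime]

theorem charIdeal_groupRing_orderTwo (a b : IwasawaAlgebra p) (h : (a + b) * (a - b) ≠ 0) :
    Module.charIdeal (IwasawaAlgebra p)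
        ((Fin 2 → IwasawaAlgebra p) ⧸ LinearMap.range (!![a, b; b, a]).mulVecLin) =
      Ideal.span {(a + b) * (a - b)} := by
  have hdet : (!![a, b; b, a]).det = (a + b) * (a - b) := by
    rw [Matrix.det_fin_two_of]; ring
  rw [← hdet] at h ⊢
  exact IwasawaAlgebra.charIdeal_quotient_range_mulVecLin_eq_span_det p _ h

end NormOrderTwo

/-! ## §D  ONE sorried abstract helper (Plan 3 only): coinvariant transport.
For `φ`-equivariant `f : M → N` with finite kernel and cokernel, the induced map on `φ`-coinvariants
`M/φM → N/φN` again has finite kernel and cokernel (kernel: extension of a quotient of `ker f` by a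
subquotient of `coker f`; cokernel: quotient of `coker f`).  With `φ = δ + 1` these are the sign-branch
coinvariants at `p = 2 = #Δ`; with `φ = γ − 1` the descent along a pro-cyclic direction. -/

section Coinv

variable {R : Type*} [CommRing R] {M N : Type*} [AddCommGroup M] [Module R M]
  [AddCommGroup N] [Module R N]

theorem range_le_comap_range {f : M →ₗ[R] N} {φM : M →ₗ[R] M} {φN : N →ₗ[R] N}
    (hcomm : f.comp φM = φN.comp f) :
    LinearMap.range φM ≤ (LinearMap.range φN).comap f := by
  rintro _ ⟨m, rfl⟩
  exact ⟨f m, (LinearMap.congr_fun hcomm m).symm⟩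

/-- The map on coinvariants `M ⧸ φM(M) → N ⧸ φN(N)` induced by an equivariant `f`. -/
def coinvMap (f : M →ₗ[R] N) (φM : M →ₗ[R] M) (φN : N →ₗ[R] N)
    (hcomm : f.comp φM = φN.comp f) :
    (M ⧸ LinearMap.range φM) →ₗ[R] (N ⧸ LinearMap.range φN) :=
  Submodule.mapQ _ _ f (range_le_comap_range hcomm)

/-- **G2 (helper stub, abstract algebra, size S).** Coinvariants preserve «finite kernel and cokernel». -/
theorem stub_coinvMap_finite_ker_coker (f : M →ₗ[R] N) (φM : M →ₗ[R] M) (φN : N →ₗ[R] N)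
    (hcomm : f.comp φM = φN.comp f) [Finite (LinearMap.ker f)] [Finite (N ⧸ LinearMap.range f)] :
    Finite (LinearMap.ker (coinvMap f φM φN hcomm)) ∧
      Finite ((N ⧸ LinearMap.range φN) ⧸ LinearMap.range (coinvMap f φM φN hcomm)) := by
  sorry

end Coinv

end Summit.BirchSwinnertonDyer.BirchSwinnertonDyer.Cruxes.SplitBadTwoLowerHalfOfFacts.StubIdeasK3G4
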